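import Literature.Analysis.FluidPDE.ChaeChoeStretchingEstimate
import Literature.Analysis.FluidPDE.EnstrophyWeightSlab
import Literature.Analysis.FluidPDE.H1ContinuationSobolevClass
import Literature.Analysis.FluidPDE.GradientRegularityCriteriaProofs
import HarnessLib

/-!
# Chae–Choe's regularity criterion: two components of the vorticity in `L^α(0,T; L^γ)`,
# `2/α + 3/γ = 2`, PROVED

search for candidate a priori estimates; no regularity claim (cell `pub-nsfunc`, literature seat:
a published continuation criterion as a THEOREM; nothing new).

Chae–Choe, *Regularity of solutions to the Navier–Stokes equation*, Electron. J. Differential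
Equations 1999 No. 05, Thm. 1: "Let `v₀ ∈ L²(ℝ³)` with `div v₀ = 0` and `ω₀ = curl v₀ ∈ L²(ℝ³)`.
If a Leray–Hopf weak solution `v` satisfies `ω̃ ∈ L^{α,γ}_T` with `2/α + 3/γ ≤ 2`, `1 < α < ∞`
and `3/2 < γ < ∞` […], then `v` becomes the classical solution on `(0, T]`" — here
`ω̃ = ω₁e₁ + ω₂e₂` is the two-component vorticity, and Remark 1: "`ω̃` is any two component
vector of `ω` … at finite blow-up time at least two components of the vortices must
simultaneously blow up".

Rendering (that of the tree's `constantin_fefferman` / `holderHalf_direction_criterion`,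
ns.S27): a classical unforced solution on `ℝ³ × [0, T)` in the Beale–Kato–Majda class on every
`[0, T'']`, `T'' < T`, two of whose vorticity components `ω_j`, `j ≠ k`, lie in
`L^α(0,T; L^γ(ℝ³))` with `2/α + 3/γ = 2`, `1 < α < ∞` (equivalently `3/2 < γ < ∞`; the equality
case of the printed `≤`, which on the bounded interval `(0,T)` is the general one up to Hölder's
inequality in time), continues in the class past `T`:

* `exists_uniform_H1_bound_of_two_vorticity_components` — the a priori bound
  `sup_{t<T} (‖u(t)‖²₂ + ‖∇u(t)‖²₂) < ∞` (the paper's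
  `ω ∈ L^∞(0,T;L²) ∩ L²(0,T;H¹)`): Tao's energy class, the fixed-time stretching estimate
  `exists_two_mul_integral_stretching_le_of_two_components` at a.e. time of each closed slab,
  the slab Grönwall bound with the integrable weight `C(‖ω_{k+1}(t)‖_γ^α + ‖ω_{k+2}(t)‖_γ^α)`
  (`integral_sq_norm_curl_le_mul_exp_of_weight_slab_ae`), uniformly in `T'' < T` since
  `∫₀ᵀ ‖ω_j‖_γ^α < ∞`, and `∫|∇u|² ≤ ∫|ω|²`;
* `chaeChoe_two_vorticity_components_criterion` — **the criterion**
  (`HasSobolevExtensionPast ν u T`, by `hasSobolevExtensionPast_of_uniform_H1_bound`);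
* `chaeChoe_two_vorticity_components_criterion_of_late` — the same with the hypothesis on a
  final segment `(t₀, T)` only (the blow-up form of Remark 1: time translation
  `IsClassicalNSSolutionOn.translate_Ico_zero`, `MemLqLp.translate`, and the Sobolev bounds on
  `[0, t₀]`).
* `exists_uniform_H1_bound_of_small_two_vorticity_components`,
  `chaeChoe_small_two_vorticity_components_criterion` — the endpoint alternative of Thm. 1
  (`α = ∞`, `γ = 3/2`): there is `ε = ε(ν) > 0` such that `‖ω_j(t)‖_{L^{3/2}} ≤ ε` for a.e.
  `t ∈ (0,T)`, `j ≠ k`, gives continuation past `T` (the enstrophy does not increase: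
  `exists_two_mul_integral_stretching_le_of_small_two_components` and the slab bound with the
  zero weight).
* `chaeChoe_two_vorticity_components_criterion_of_le` — the printed hypothesis
  `2/α + 3/γ ≤ 2`, `1 < α ≤ ∞`, `3/2 < γ < ∞`, reduced to the critical case by Hölder's
  inequality in time (`MemLqLp.of_exponent_le`, with the time measurability of the slice norms
  of a classical solution);
* `hasSobolevExtensionPast_of_two_vorticity_components_eq_zero` — Remark 2 (two vorticity
  components vanish identically: continuation).

Thm. 2 (two velocity components) is not formalised here.

## Mathlib / tree search

Tree: `exists_two_mul_integral_stretching_le_of_two_components` (`ChaeChoeStretchingEstimate`),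
`integral_sq_norm_curl_le_mul_exp_of_weight_slab_ae` (`EnstrophyWeightSlab`),
`hasSobolevExtensionPast_of_uniform_H1_bound` (`H1ContinuationSobolevClass`),
`tao_finite_energy_smooth_energy_bound_holds`, `bdv_exponents`,
`lintegral_ofReal_rpow_gradient_lt_top` (`GradientRegularityCriteriaProofs`),
`lintegral_frobeniusNormSq_fderiv_le_lintegral_sq_norm_curl`,
`linfty_bound_of_hasBoundedSobolevNormsOn_holds`,
`exists_forall_norm_fderiv_le_of_hasBoundedSobolevNormsOn`, `lintegral_curl_sq_le`; pattern of
`exists_uniform_H1_bound_of_holderHalf_direction` (`HolderHalfDirectionCriterion`).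

## References

* D. Chae, H.-J. Choe, *Regularity of solutions to the Navier–Stokes equation*, Electron. J.
  Differential Equations 1999 (1999), No. 05, 1–7: Thm. 1, Remark 1 and the proof pp. 3–4 (open
  access; text read). [ChaeChoe1999]
* D. Chae, Rev. Mat. Iberoam. 23 (2007) 371–384, p. 372 (the criterion restated after (1.8)).
  [Chae2007RMI]
* T. Tao, Anal. PDE 6 (2013), Lemma 8.1 (energy class). [Tao2011]
* J. Serrin, in *Nonlinear Problems* (1963), §3 (the mixed classes `L^{q}(L^{p})`; Hölder in
  time). [Serrin1963]
-/

noncomputable section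

open MeasureTheory Set Function Filter Metric Real InnerProductSpace
open _root_.Topology
open scoped ENNReal NNReal RealInnerProductSpace ContDiff

namespace Literature.Analysis.FluidPDE

-- nested operator types (second derivatives)
set_option maxSynthPendingDepth 3

/-- In `Fin 3`, `k + 1 ≠ k`. [folklore] -/
private theorem fin3_add_one_ne (k : Fin 3) : k + 1 ≠ k := by
  fin_cases k <;> decide

/-- In `Fin 3`, `k + 2 ≠ k`. [folklore] -/
private theorem fin3_add_two_ne (k : Fin 3) : k + 2 ≠ k := by
  fin_cases k <;> decide

set_option maxHeartbeats 1600000 in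
/-- **The a priori `H¹` bound under Chae–Choe's hypothesis** (Chae–Choe 1999, proof of Thm. 1:
"`sup_{0≤t≤T} ‖ω(t)‖²₂ + ν∫₀ᵀ‖∇ω‖²₂ ≤ ‖ω₀‖²₂ exp(C‖ω̃‖^{2γ/(2γ−3)}_{L^{α,γ}_T} T^{…})`. Thus
`‖ω̃‖_{L^{α,γ}_T} < ∞` implies `ω ∈ L^∞(0,T;L²) ∩ L²(0,T;H¹)`"). Let `ν > 0`, `T > 0`, and let
`(u, p)` be a classical unforced Navier–Stokes solution on `ℝ³ × [0, T)` with all `L²` Sobolev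
seminorms bounded on every `[0, T'']`, `T'' < T`. If for an index `k` the two other vorticity
components satisfy `ω_j ∈ L^α(0,T; L^γ(ℝ³))`, `j ≠ k`, with `2/α + 3/γ = 2`, `1 < α < ∞`, then
`‖u(t)‖²_{L²} + ‖∇u(t)‖²_{L²}` is bounded on `[0, T)`. Proof: Tao's energy class; on each slab
`[0, T'']` the stretching estimate `exists_two_mul_integral_stretching_le_of_two_components` at
a.e. time (where `ω_j(t) ∈ L^γ`), the slab Grönwall bound
`integral_sq_norm_curl_le_mul_exp_of_weight_slab_ae` with the weight
`C(‖ω_{k+1}(t)‖_γ^α + ‖ω_{k+2}(t)‖_γ^α)` whose integral over `(0, T)` is finite, and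
`∫|∇u|² ≤ ∫|ω|²`. [cite: ChaeChoe1999, Thm. 1 and proof (pp. 2–4); Tao2011, Lemma 8.1] -/
theorem exists_uniform_H1_bound_of_two_vorticity_components {ν T : ℝ} (hν : 0 < ν) (hT : 0 < T)
    {u : ℝ → (EuclideanSpace ℝ (Fin 3)) → (EuclideanSpace ℝ (Fin 3))}
    {p : ℝ → (EuclideanSpace ℝ (Fin 3)) → ℝ}
    (hsol : IsClassicalNSSolutionOn (Ico 0 T) ν 0 u p)
    (hreg : ∀ T'' < T, HasBoundedSobolevNormsOn (Icc 0 T'') u)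
    {α γ : ℝ≥0∞} (h1α : 1 < α) (hαtop : α < ⊤) (hαγ : 2 / α + 3 / γ = 2) (k : Fin 3)
    (hω : ∀ j, j ≠ k → MemLqLp α γ (fun t x => curl (u t) x j) (Ioo 0 T)) :
    ∃ A : ℝ, 0 ≤ A ∧ ∀ t ∈ Ico 0 T,
      (∫⁻ x, ‖u t x‖ₑ ^ 2) + (∫⁻ x, ENNReal.ofReal (frobeniusNormSq (fderiv ℝ (u t) x))) ≤
        ENNReal.ofReal A := by
  obtain ⟨Ce, hCetop, hTao⟩ := tao_finite_energy_smooth_energy_bound_holds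
  -- exponents and the stretching constant
  obtain ⟨hγtop, hγ, hαq⟩ := bdv_exponents h1α hαtop hαγ
  set q : ℝ := 1 / (1 - 3 / (2 * γ.toReal)) with hq
  have hq0 : 0 ≤ q := by rw [← hαq]; exact ENNReal.toReal_nonneg
  obtain ⟨C, hC0, hstrC⟩ := exists_two_mul_integral_stretching_le_of_two_components hγ hγtop hν k
  -- the time weights of the two controlled components
  set N : Fin 3 → ℝ → ℝ := fun j t => (eLpNorm (fun x => curl (u t) x j) γ volume).toReal with hN
  have hN0 : ∀ j t, 0 ≤ N j t := fun j t => ENNReal.toReal_nonneg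
  obtain ⟨hI1, hae1⟩ := lintegral_ofReal_rpow_gradient_lt_top h1α hαtop hαγ (hω (k + 1) (fin3_add_one_ne k))
  obtain ⟨hI2, hae2⟩ := lintegral_ofReal_rpow_gradient_lt_top h1α hαtop hαγ (hω (k + 2) (fin3_add_two_ne k))
  set I₁ : ℝ≥0∞ := ∫⁻ t in Ioo 0 T, ENNReal.ofReal (N (k + 1) t ^ q) with hI₁
  set I₂ : ℝ≥0∞ := ∫⁻ t in Ioo 0 T, ENNReal.ofReal (N (k + 2) t ^ q) with hI₂
  have hI₁top : I₁ < ⊤ := hI1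
  have hI₂top : I₂ < ⊤ := hI2
  set a : ℝ → ℝ := fun t => C * (N (k + 1) t ^ q + N (k + 2) t ^ q) with ha
  have ha0 : ∀ t, 0 ≤ a t := fun t => by positivity
  set Aw : ℝ := C * (I₁ + I₂).toReal with hAw
  have hAw0 : 0 ≤ Aw := by positivity
  have haE : ∀ t, ENNReal.ofReal (a t) =
      ENNReal.ofReal C * (ENNReal.ofReal (N (k + 1) t ^ q) + ENNReal.ofReal (N (k + 2) t ^ q)) := by
    intro t
    rw [ha]; dsimp only
    rw [ENNReal.ofReal_mul hC0, ENNReal.ofReal_add (by positivity) (by positivity)]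
  -- measurability in time of the weights (joint continuity of `∇u` on `(0,T) × ℝ³` and Tonelli)
  have hγ0 : γ ≠ 0 := (lt_trans (by norm_num) hγ).ne'
  have hD : IsSmoothSpaceTimeOn (Ico 0 T) (fun t x => fderiv ℝ (u t) x) :=
    hsol.smooth_velocity.fderiv_slice (uniqueDiffOn_Ico 0 T)
  have hcD : ContinuousOn (fun z : ℝ × EuclideanSpace ℝ (Fin 3) => fderiv ℝ (u z.1) z.2)
      (Ioo 0 T ×ˢ univ) :=
    hD.continuousOn.mono (prod_mono Ioo_subset_Ico_self Subset.rfl)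
  have hmeasD : AEStronglyMeasurable (fun z : ℝ × EuclideanSpace ℝ (Fin 3) => fderiv ℝ (u z.1) z.2)
      ((volume.restrict (Ioo 0 T)).prod volume) := by
    rw [Measure.restrict_prod_eq_prod_univ]
    exact hcD.aestronglyMeasurable (measurableSet_Ioo.prod MeasurableSet.univ)
  have hNmeas : ∀ j, AEMeasurable (fun t => ENNReal.ofReal (N j t ^ q)) (volume.restrict (Ioo 0 T)) := by
    intro j
    have hmj : AEStronglyMeasurable (fun z : ℝ × EuclideanSpace ℝ (Fin 3) => curl (u z.1) z.2 j)
        ((volume.restrict (Ioo 0 T)).prod volume) :=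
      ((EuclideanSpace.proj j).continuous.comp curlCLM.continuous).comp_aestronglyMeasurable hmeasD
    have hG : AEMeasurable (fun t => ∫⁻ x, ‖curl (u t) x j‖ₑ ^ γ.toReal) (volume.restrict (Ioo 0 T)) :=
      (hmj.enorm.pow_const _).lintegral_prod_right'
    have hE : AEMeasurable (fun t => eLpNorm (fun x => curl (u t) x j) γ volume)
        (volume.restrict (Ioo 0 T)) := by
      have heq : (fun t => eLpNorm (fun x => curl (u t) x j) γ volume) =
          fun t => (∫⁻ x, ‖curl (u t) x j‖ₑ ^ γ.toReal) ^ (1 / γ.toReal) :=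
        funext fun t => eLpNorm_eq_lintegral_rpow_enorm_toReal hγ0 hγtop
      rw [heq]
      exact hG.pow_const _
    have hNj : AEMeasurable (N j) (volume.restrict (Ioo 0 T)) :=
      ENNReal.measurable_toReal.comp_aemeasurable hE
    exact ENNReal.measurable_ofReal.comp_aemeasurable (hNj.pow_const q)
  have hAint : ∀ T'' ≤ T, ∫⁻ t in Ioo 0 T'', ENNReal.ofReal (a t) ≤ ENNReal.ofReal Aw := by
    intro T'' hT''
    have hCtop : ENNReal.ofReal C ≠ ⊤ := ENNReal.ofReal_ne_top
    calc ∫⁻ t in Ioo 0 T'', ENNReal.ofReal (a t)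
        ≤ ∫⁻ t in Ioo 0 T, ENNReal.ofReal (a t) := lintegral_mono_set (Ioo_subset_Ioo le_rfl hT'')
      _ = ∫⁻ t in Ioo 0 T, ENNReal.ofReal C *
            (ENNReal.ofReal (N (k + 1) t ^ q) + ENNReal.ofReal (N (k + 2) t ^ q)) :=
          lintegral_congr fun t => haE t
      _ = ENNReal.ofReal C * (I₁ + I₂) := by
          rw [lintegral_const_mul' _ _ hCtop, lintegral_add_left' (hNmeas (k + 1))]
      _ = ENNReal.ofReal Aw := by
          rw [hAw, ENNReal.ofReal_mul hC0, ENNReal.ofReal_toReal]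
          exact (ENNReal.add_lt_top.2 ⟨hI₁top, hI₂top⟩).ne
  -- a.e. finiteness of the two vorticity components in `L^γ`
  have hae1' : ∀ᵐ s ∂volume, s ∈ Ioo 0 T → eLpNorm (fun x => curl (u s) x (k + 1)) γ volume < ⊤ := hae1
  have hae2' : ∀ᵐ s ∂volume, s ∈ Ioo 0 T → eLpNorm (fun x => curl (u s) x (k + 2)) γ volume < ⊤ := hae2
  -- the initial energy and enstrophy
  have hreg0 : HasBoundedSobolevNormsOn (Icc 0 (T / 2)) u := hreg (T / 2) (by linarith)
  have h00 : (0 : ℝ) ∈ Icc 0 (T / 2) := ⟨le_rfl, by linarith⟩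
  set E₀ : ℝ≥0∞ := ∫⁻ x, ‖u 0 x‖ₑ ^ 2 with hE₀
  have hE₀top : E₀ < ⊤ := by
    obtain ⟨C0, hC0'⟩ := hreg0 0
    refine lt_of_le_of_lt (le_of_eq (lintegral_congr fun x => ?_)) ((hC0' 0 h00).trans_lt ENNReal.coe_lt_top)
    rw [← ofReal_norm, ← ofReal_norm, norm_iteratedFDeriv_zero]
  have hCE : Ce * E₀ < ⊤ := ENNReal.mul_lt_top hCetop hE₀top
  set Ē : ℝ := (Ce * E₀).toReal with hĒ
  have hĒ0 : 0 ≤ Ē := ENNReal.toReal_nonneg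
  set Y₀ : ℝ := ∫ x, ‖curl (u 0) x‖ ^ 2 with hY₀
  have hY₀0 : 0 ≤ Y₀ := integral_nonneg fun x => sq_nonneg _
  set Ystar : ℝ := Y₀ * Real.exp Aw with hYstar
  have hYstar0 : 0 ≤ Ystar := by positivity
  refine ⟨Ē + Ystar, by positivity, ?_⟩
  intro t ht
  -- a closed slab containing `t`
  set T'' : ℝ := (t + T) / 2 with hT''def
  have htT'' : t < T'' := by rw [hT''def]; linarith [ht.2]
  have hT''T : T'' < T := by rw [hT''def]; linarith [ht.2]
  have hT''pos : 0 < T'' := lt_of_le_of_lt ht.1 htT''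
  have hS : IsClassicalNSSolutionOn (Icc 0 T'') ν 0 u p :=
    hsol.mono (Icc_subset_Ico_right hT''T) (uniqueDiffOn_Icc hT''pos)
  have hB : HasBoundedSobolevNormsOn (Icc 0 T'') u := hreg T'' hT''T
  have htS : t ∈ Icc 0 T'' := ⟨ht.1, htT''.le⟩
  have hsm : ∀ s ∈ Icc 0 T'', ContDiff ℝ ∞ (u s) := fun s hs => hS.contDiff_velocity hs
  have hsm3 : ∀ s ∈ Icc 0 T'', ContDiff ℝ 3 (u s) := fun s hs => (hsm s hs).of_le (by norm_cast)
  have hsm2 : ∀ s ∈ Icc 0 T'', ContDiff ℝ 2 (u s) := fun s hs => (hsm s hs).of_le (by norm_cast)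
  have hfin : ∀ n, ∀ s ∈ Icc 0 T'', ∫⁻ x, ‖iteratedFDeriv ℝ n (u s) x‖ₑ ^ 2 < ⊤ := fun n s hs => by
    obtain ⟨Cn, hCn⟩ := hB n
    exact (hCn s hs).trans_lt ENNReal.coe_lt_top
  obtain ⟨B₀, hB₀⟩ := linfty_bound_of_hasBoundedSobolevNormsOn_holds hsm2 hB
  obtain ⟨B₁, hB₁0, hB₁⟩ := exists_forall_norm_fderiv_le_of_hasBoundedSobolevNormsOn hsm3 hB
  -- Tao's energy class on the slab
  have hfe : ∃ A : ℝ≥0∞, A < ⊤ ∧ ∀ s ∈ Icc 0 T'', ∫⁻ x, ‖u s x‖ₑ ^ 2 ≤ A := by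
    obtain ⟨C0, hC0'⟩ := hB 0
    refine ⟨C0, ENNReal.coe_lt_top, fun s hs => ?_⟩
    refine le_trans (le_of_eq (lintegral_congr fun x => ?_)) (hC0' s hs)
    rw [← ofReal_norm, ← ofReal_norm, norm_iteratedFDeriv_zero]
  obtain ⟨hen, -⟩ := hTao ν T'' hν hT''pos u p hS hfe
  have hen' : ∀ s ∈ Icc 0 T'', ∫⁻ x, ‖u s x‖ₑ ^ 2 ≤ ENNReal.ofReal Ē := fun s hs => by
    rw [hĒ, ENNReal.ofReal_toReal hCE.ne]
    exact hen s hs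
  -- the slices on the slab: `L²`, `L^∞` tails
  have hL2 : ∀ s ∈ Icc 0 T'', eLpNorm (u s) 2 volume < ⊤ := fun s hs => by
    refine eLpNorm_two_lt_top_of_lintegral_enorm_sq_lt_top ?_
    exact (hen' s hs).trans_lt ENNReal.ofReal_lt_top
  have hLinf : ∀ s ∈ Icc 0 T'', eLpNorm (u s) ⊤ volume < ⊤ := fun s hs => by
    rw [eLpNorm_exponent_top]
    refine lt_of_le_of_lt (eLpNormEssSup_le_of_ae_enorm_bound (C := ENNReal.ofReal B₀)
      (Eventually.of_forall fun x => ?_)) ENNReal.ofReal_lt_top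
    rw [← ofReal_norm]
    exact ENNReal.ofReal_le_ofReal (hB₀ s hs x)
  -- the stretching estimate at a.e. time of the slab
  have hstrS : ∀ᵐ s ∂(volume.restrict (Ioo 0 T'')),
      2 * ∫ x, ⟪curl (u s) x, fderiv ℝ (u s) x (curl (u s) x)⟫ ≤
        ν * (∫ x, frobeniusNormSq (fderiv ℝ (curl (u s)) x)) + a s * (∫ x, ‖curl (u s) x‖ ^ 2) := by
    rw [ae_restrict_iff' measurableSet_Ioo]
    filter_upwards [hae1', hae2'] with s h1 h2 hsI
    have hsT : s ∈ Ioo 0 T := ⟨hsI.1, hsI.2.trans hT''T⟩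
    have hsS : s ∈ Icc 0 T'' := ⟨hsI.1.le, hsI.2.le⟩
    exact hstrC (u s) (hsm s hsS) (hS.divFree s hsS) (hL2 s hsS) (hLinf s hsS) (hB₁ s hsS)
      (hfin 1 s hsS) (hfin 2 s hsS) (h1 hsT) (h2 hsT)
  -- the enstrophy bound on the slab
  have hY := integral_sq_norm_curl_le_mul_exp_of_weight_slab_ae hν hT''pos hS hB ha0 hAw0
    (hAint T'' hT''T.le) hstrS t htS
  have hYstar_le : ∫ x, ‖curl (u t) x‖ ^ 2 ≤ Ystar := hY
  -- the `H¹` quantity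
  have hvt : ContDiff ℝ ∞ (u t) := hS.contDiff_velocity htS
  have hcurl_int : Integrable fun x => ‖curl (u t) x‖ ^ 2 := by
    refine integrable_sq_norm_of_lintegral_lt_top (continuous_curl (hvt.of_le (by norm_cast))) ?_
    exact lt_of_le_of_lt (lintegral_curl_sq_le (u t)) (ENNReal.mul_lt_top ENNReal.ofReal_lt_top (hfin 1 t htS))
  have hdc : ∫⁻ x, ENNReal.ofReal (frobeniusNormSq (fderiv ℝ (u t) x)) ≤ ENNReal.ofReal Ystar := by
    refine (lintegral_frobeniusNormSq_fderiv_le_lintegral_sq_norm_curl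
      (hvt.of_le (by norm_cast)) (hS.divFree t htS)
      ((hen' t htS).trans_lt ENNReal.ofReal_lt_top)).trans ?_
    rw [show (∫⁻ x, ‖curl (u t) x‖ₑ ^ 2) = ∫⁻ x, ENNReal.ofReal (‖curl (u t) x‖ ^ 2) from
      lintegral_congr fun x => by rw [← ofReal_norm, ENNReal.ofReal_pow (norm_nonneg _)],
      ← ofReal_integral_eq_lintegral_ofReal hcurl_int (Eventually.of_forall fun x => sq_nonneg _)]
    exact ENNReal.ofReal_le_ofReal hYstar_le
  calc (∫⁻ x, ‖u t x‖ₑ ^ 2) + (∫⁻ x, ENNReal.ofReal (frobeniusNormSq (fderiv ℝ (u t) x)))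
      ≤ ENNReal.ofReal Ē + ENNReal.ofReal Ystar := add_le_add (hen' t htS) hdc
    _ = ENNReal.ofReal (Ē + Ystar) := (ENNReal.ofReal_add hĒ0 hYstar0).symm

/-- **Chae–Choe's two-vorticity-components criterion** (Chae–Choe 1999, Thm. 1 with Remark 1,
in the rendering of the tree's `constantin_fefferman`, ns.S27). Let `ν > 0`, `T > 0`, and let
`(u, p)` be a classical unforced Navier–Stokes solution on `ℝ³ × [0, T)` in the Beale–Kato–Majda
class on every compact `[0, T''] ⊆ [0, T)`. If for some index `k` the two OTHER components of the
vorticity, `ω_j = (curl u)_j`, `j ≠ k`, belong to `L^α(0,T; L^γ(ℝ³))` with `2/α + 3/γ = 2`,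
`1 < α < ∞` (`⇔ 3/2 < γ < ∞`), then the solution continues in the class past `T`
(`HasSobolevExtensionPast ν u T`). Printed: Leray–Hopf weak solution with `ω₀ ∈ L²` and
`ω̃ = ω₁e₁ + ω₂e₂ ∈ L^α(0,T;L^γ)`, `2/α + 3/γ ≤ 2`, `1 < α < ∞`, `3/2 < γ < ∞` ⇒ classical on
`(0,T]`; "`ω̃` is any two component vector of `ω`". The small-`L^∞(0,T;L^{3/2})` alternative
and Thm. 2 are not covered. [cite: ChaeChoe1999, Thm. 1 and Remark 1 (p. 2), proof pp. 3–4; Chae2007RMI, p. 372 (after (1.8))] -/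
theorem chaeChoe_two_vorticity_components_criterion {ν : ℝ} (hν : 0 < ν) {T : ℝ} (hT : 0 < T)
    {u : ℝ → (EuclideanSpace ℝ (Fin 3)) → (EuclideanSpace ℝ (Fin 3))}
    {p : ℝ → (EuclideanSpace ℝ (Fin 3)) → ℝ}
    (hsol : IsClassicalNSSolutionOn (Ico 0 T) ν 0 u p)
    (hreg : ∀ T'' < T, HasBoundedSobolevNormsOn (Icc 0 T'') u)
    {α γ : ℝ≥0∞} (h1α : 1 < α) (hαtop : α < ⊤) (hαγ : 2 / α + 3 / γ = 2) (k : Fin 3)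
    (hω : ∀ j, j ≠ k → MemLqLp α γ (fun t x => curl (u t) x j) (Ioo 0 T)) :
    HasSobolevExtensionPast ν u T := by
  obtain ⟨A, hA0, hA⟩ :=
    exists_uniform_H1_bound_of_two_vorticity_components hν hT hsol hreg h1α hαtop hαγ k hω
  exact hasSobolevExtensionPast_of_uniform_H1_bound hν hT hsol hreg hA0 hA

/-! ### Hypothesis near the final time only -/

/-- **A uniform `H¹` bound from a uniform `H¹` bound near the final time.** If a classical solution
in the Beale–Kato–Majda class on every `[0, T'']`, `T'' < T`, has `‖u(t)‖²_{L²} + ‖∇u(t)‖²_{L²}`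
bounded on `[t₀, T)` for some `t₀ < T`, then it is bounded on `[0, T)` (on `[0, t₀]` by the
Sobolev bounds of orders `0` and `1`, `|∇u|²_F ≤ 3‖∇u‖²`). (The same elementary step as in
`HolderHalfDirectionCriterion.lean`, where it is file-private.) [folklore] -/
private theorem exists_uniform_H1_bound_of_late_cc {T t₀ : ℝ} (ht₀T : t₀ < T)
    {u : ℝ → (EuclideanSpace ℝ (Fin 3)) → (EuclideanSpace ℝ (Fin 3))}
    (hreg : ∀ T'' < T, HasBoundedSobolevNormsOn (Icc 0 T'') u) {A : ℝ} (hA0 : 0 ≤ A)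
    (hA : ∀ t ∈ Ico t₀ T,
      (∫⁻ x, ‖u t x‖ₑ ^ 2) + (∫⁻ x, ENNReal.ofReal (frobeniusNormSq (fderiv ℝ (u t) x))) ≤
        ENNReal.ofReal A) :
    ∃ A' : ℝ, 0 ≤ A' ∧ ∀ t ∈ Ico 0 T,
      (∫⁻ x, ‖u t x‖ₑ ^ 2) + (∫⁻ x, ENNReal.ofReal (frobeniusNormSq (fderiv ℝ (u t) x))) ≤
        ENNReal.ofReal A' := by
  have hB : HasBoundedSobolevNormsOn (Icc 0 t₀) u := hreg t₀ ht₀T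
  obtain ⟨C0, hC0⟩ := hB 0
  obtain ⟨C1, hC1⟩ := hB 1
  refine ⟨A + ((C0 : ℝ) + 3 * (C1 : ℝ)), by positivity, fun t ht => ?_⟩
  by_cases hlt : t < t₀
  · have htI : t ∈ Icc 0 t₀ := ⟨ht.1, hlt.le⟩
    have h0 : ∫⁻ x, ‖u t x‖ₑ ^ 2 ≤ (C0 : ℝ≥0∞) := by
      refine le_trans (le_of_eq (lintegral_congr fun x => ?_)) (hC0 t htI)
      rw [← ofReal_norm, ← ofReal_norm, norm_iteratedFDeriv_zero]
    have h1 : ∫⁻ x, ENNReal.ofReal (frobeniusNormSq (fderiv ℝ (u t) x)) ≤ 3 * (C1 : ℝ≥0∞) := by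
      calc ∫⁻ x, ENNReal.ofReal (frobeniusNormSq (fderiv ℝ (u t) x))
          ≤ ∫⁻ x, 3 * ‖iteratedFDeriv ℝ 1 (u t) x‖ₑ ^ 2 := by
            refine lintegral_mono fun x => ?_
            have h3 : ENNReal.ofReal (frobeniusNormSq (fderiv ℝ (u t) x)) ≤
                ENNReal.ofReal (3 * ‖fderiv ℝ (u t) x‖ ^ 2) :=
              ENNReal.ofReal_le_ofReal (frobeniusNormSq_le_three_mul _)
            refine h3.trans (le_of_eq ?_)
            rw [← norm_iteratedFDeriv_one (u t), ENNReal.ofReal_mul (by norm_num : (0 : ℝ) ≤ 3),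
              ENNReal.ofReal_pow (norm_nonneg _), ofReal_norm, ENNReal.ofReal_ofNat]
        _ = 3 * ∫⁻ x, ‖iteratedFDeriv ℝ 1 (u t) x‖ₑ ^ 2 := by
            rw [lintegral_const_mul' _ _ (by norm_num)]
        _ ≤ 3 * (C1 : ℝ≥0∞) := mul_le_mul_right (hC1 t htI) _
    calc (∫⁻ x, ‖u t x‖ₑ ^ 2) + (∫⁻ x, ENNReal.ofReal (frobeniusNormSq (fderiv ℝ (u t) x)))
        ≤ (C0 : ℝ≥0∞) + 3 * (C1 : ℝ≥0∞) := add_le_add h0 h1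
      _ = ENNReal.ofReal ((C0 : ℝ) + 3 * (C1 : ℝ)) := by
          rw [ENNReal.ofReal_add (NNReal.coe_nonneg _) (by positivity), ENNReal.ofReal_coe_nnreal,
            ENNReal.ofReal_mul (by norm_num), ENNReal.ofReal_coe_nnreal, ENNReal.ofReal_ofNat]
      _ ≤ ENNReal.ofReal (A + ((C0 : ℝ) + 3 * (C1 : ℝ))) :=
          ENNReal.ofReal_le_ofReal (le_add_of_nonneg_left hA0)
  · have htI : t ∈ Ico t₀ T := ⟨not_lt.1 hlt, ht.2⟩
    exact (hA t htI).trans (ENNReal.ofReal_le_ofReal (le_add_of_nonneg_right (by positivity)))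

/-- **Chae–Choe's criterion, hypothesis near the final time only** (the blow-up form of
Chae–Choe 1999, Remark 1: "if the classical solution of the 3-D Navier–Stokes equations blows up
at time `T`, then `‖ω̃‖_{L^{α,γ}_T} = ∞`, where `ω̃` is any two component vector of `ω`" — since a
classical solution in the Beale–Kato–Majda class has `ω̃ ∈ L^α(0, t₀; L^γ)` automatically only
for `γ ≥ 2`, the useful localisation is: two vorticity components in `L^α(t₀, T; L^γ)` for SOME
`0 ≤ t₀ < T` already give continuation past `T`). Proof: the a priori bound
`exists_uniform_H1_bound_of_two_vorticity_components` for the time-translate `u(· + t₀)`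
(a classical solution on `[0, T − t₀)`, `IsClassicalNSSolutionOn.translate_Ico_zero`; the
hypothesis translates by `MemLqLp.translate`), the trivial bound on `[0, t₀]`
(`exists_uniform_H1_bound_of_late_cc`), and `hasSobolevExtensionPast_of_uniform_H1_bound` for `u`
itself. [cite: ChaeChoe1999, Thm. 1 and Remark 1 (p. 2); Chae2007RMI, p. 372 (after (1.8))] -/
theorem chaeChoe_two_vorticity_components_criterion_of_late {ν : ℝ} (hν : 0 < ν) {T t₀ : ℝ}
    (ht₀ : 0 ≤ t₀) (ht₀T : t₀ < T)
    {u : ℝ → (EuclideanSpace ℝ (Fin 3)) → (EuclideanSpace ℝ (Fin 3))}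
    {p : ℝ → (EuclideanSpace ℝ (Fin 3)) → ℝ}
    (hsol : IsClassicalNSSolutionOn (Ico 0 T) ν 0 u p)
    (hreg : ∀ T'' < T, HasBoundedSobolevNormsOn (Icc 0 T'') u)
    {α γ : ℝ≥0∞} (h1α : 1 < α) (hαtop : α < ⊤) (hαγ : 2 / α + 3 / γ = 2) (k : Fin 3)
    (hω : ∀ j, j ≠ k → MemLqLp α γ (fun t x => curl (u t) x j) (Ioo t₀ T)) :
    HasSobolevExtensionPast ν u T := by
  have hT : 0 < T := lt_of_le_of_lt ht₀ ht₀T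
  have hTt : 0 < T - t₀ := by linarith
  -- the translate
  have hsol' : IsClassicalNSSolutionOn (Ico 0 (T - t₀)) ν 0 (fun t => u (t + t₀))
      (fun t => p (t + t₀)) := hsol.translate_Ico_zero ht₀
  have hreg' : ∀ T'' < T - t₀, HasBoundedSobolevNormsOn (Icc 0 T'') (fun t => u (t + t₀)) := by
    intro T'' hT'' n
    obtain ⟨C, hC⟩ := hreg (T'' + t₀) (by linarith) n
    exact ⟨C, fun t ht => hC (t + t₀) ⟨by linarith [ht.1], by linarith [ht.2]⟩⟩
  have hω' : ∀ j, j ≠ k →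
      MemLqLp α γ (fun t x => curl ((fun s => u (s + t₀)) t) x j) (Ioo 0 (T - t₀)) := by
    intro j hj
    have h : MemLqLp α γ (fun t x => curl (u t) x j) (Ioo (0 + t₀) (T - t₀ + t₀)) := by
      rw [zero_add, sub_add_cancel]; exact hω j hj
    exact MemLqLp.translate t₀ h
  obtain ⟨A, hA0, hA⟩ :=
    exists_uniform_H1_bound_of_two_vorticity_components hν hTt hsol' hreg' h1α hαtop hαγ k hω'
  -- back to `u` on `[t₀, T)`
  have hAu : ∀ t ∈ Ico t₀ T,
      (∫⁻ x, ‖u t x‖ₑ ^ 2) + (∫⁻ x, ENNReal.ofReal (frobeniusNormSq (fderiv ℝ (u t) x))) ≤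
        ENNReal.ofReal A := by
    intro t ht
    have h := hA (t - t₀) ⟨by linarith [ht.1], by linarith [ht.2]⟩
    simp only [sub_add_cancel] at h
    exact h
  obtain ⟨A', hA'0, hA'⟩ := exists_uniform_H1_bound_of_late_cc ht₀T hreg hA0 hAu
  exact hasSobolevExtensionPast_of_uniform_H1_bound hν hT hsol hreg hA'0 hA'

/-! ### The endpoint `γ = 3/2`: small data -/

set_option maxHeartbeats 800000 in
/-- **The a priori `H¹` bound under Chae–Choe's smallness hypothesis at the endpoint `γ = 3/2`**
(Chae–Choe 1999, proof of Thm. 1, the case `α = ∞, γ = 3/2`, (10)–(11): "thus, if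
`C‖ω̃‖_{L^{∞,3/2}_T} < ν/2`, then we have again `ω ∈ L^∞(0,T;L²) ∩ L²(0,T;H¹)`"). For `ν > 0`
and an index `k` there is `ε = ε(ν) > 0` such that: if `(u, p)` is a classical unforced
Navier–Stokes solution on `ℝ³ × [0, T)` with all `L²` Sobolev seminorms bounded on every
`[0, T'']`, `T'' < T`, and the two other vorticity components satisfy `‖ω_j(t)‖_{L^{3/2}} ≤ ε`
for a.e. `t ∈ (0, T)`, `j ≠ k`, then `‖u(t)‖²_{L²} + ‖∇u(t)‖²_{L²}` is bounded on `[0, T)` — in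
fact `∫|ω(t)|² ≤ ∫|ω(0)|²`. Proof: Tao's energy class; on each slab `[0, T'']` the endpoint
stretching estimate `exists_two_mul_integral_stretching_le_of_small_two_components` at a.e. time
and the slab bound `integral_sq_norm_curl_le_mul_exp_of_weight_slab_ae` with the zero weight;
`∫|∇u|²_F ≤ ∫|ω|²`. [cite: ChaeChoe1999, Thm. 1 and proof, (10)–(11) (p. 5); Tao2011, Lemma 8.1] -/
theorem exists_uniform_H1_bound_of_small_two_vorticity_components {ν : ℝ} (hν : 0 < ν)
    (k : Fin 3) :
    ∃ ε : ℝ, 0 < ε ∧ ∀ {T : ℝ}, 0 < T →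
      ∀ {u : ℝ → (EuclideanSpace ℝ (Fin 3)) → (EuclideanSpace ℝ (Fin 3))}
        {p : ℝ → (EuclideanSpace ℝ (Fin 3)) → ℝ},
      IsClassicalNSSolutionOn (Ico 0 T) ν 0 u p →
      (∀ T'' < T, HasBoundedSobolevNormsOn (Icc 0 T'') u) →
      (∀ j, j ≠ k → ∀ᵐ t ∂(volume.restrict (Ioo 0 T)),
        eLpNorm (fun x => curl (u t) x j) (3 / 2) volume ≤ ENNReal.ofReal ε) →
      ∃ A : ℝ, 0 ≤ A ∧ ∀ t ∈ Ico 0 T,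
        (∫⁻ x, ‖u t x‖ₑ ^ 2) + (∫⁻ x, ENNReal.ofReal (frobeniusNormSq (fderiv ℝ (u t) x))) ≤
          ENNReal.ofReal A := by
  obtain ⟨Ce, hCetop, hTao⟩ := tao_finite_energy_smooth_energy_bound_holds
  obtain ⟨ε, hε0, hstrε⟩ := exists_two_mul_integral_stretching_le_of_small_two_components hν k
  refine ⟨ε, hε0, ?_⟩
  intro T hT u p hsol hreg hω
  have hω1 := hω (k + 1) (fin3_add_one_ne k)
  have hω2 := hω (k + 2) (fin3_add_two_ne k)
  -- the initial energy and enstrophy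
  have hreg0 : HasBoundedSobolevNormsOn (Icc 0 (T / 2)) u := hreg (T / 2) (by linarith)
  have h00 : (0 : ℝ) ∈ Icc 0 (T / 2) := ⟨le_rfl, by linarith⟩
  set E₀ : ℝ≥0∞ := ∫⁻ x, ‖u 0 x‖ₑ ^ 2 with hE₀
  have hE₀top : E₀ < ⊤ := by
    obtain ⟨C0, hC0'⟩ := hreg0 0
    refine lt_of_le_of_lt (le_of_eq (lintegral_congr fun x => ?_)) ((hC0' 0 h00).trans_lt ENNReal.coe_lt_top)
    rw [← ofReal_norm, ← ofReal_norm, norm_iteratedFDeriv_zero]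
  have hCE : Ce * E₀ < ⊤ := ENNReal.mul_lt_top hCetop hE₀top
  set Ē : ℝ := (Ce * E₀).toReal with hĒ
  have hĒ0 : 0 ≤ Ē := ENNReal.toReal_nonneg
  set Y₀ : ℝ := ∫ x, ‖curl (u 0) x‖ ^ 2 with hY₀
  have hY₀0 : 0 ≤ Y₀ := integral_nonneg fun x => sq_nonneg _
  refine ⟨Ē + Y₀, by positivity, ?_⟩
  intro t ht
  -- a closed slab containing `t`
  set T'' : ℝ := (t + T) / 2 with hT''def
  have htT'' : t < T'' := by rw [hT''def]; linarith [ht.2]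
  have hT''T : T'' < T := by rw [hT''def]; linarith [ht.2]
  have hT''pos : 0 < T'' := lt_of_le_of_lt ht.1 htT''
  have hS : IsClassicalNSSolutionOn (Icc 0 T'') ν 0 u p :=
    hsol.mono (Icc_subset_Ico_right hT''T) (uniqueDiffOn_Icc hT''pos)
  have hB : HasBoundedSobolevNormsOn (Icc 0 T'') u := hreg T'' hT''T
  have htS : t ∈ Icc 0 T'' := ⟨ht.1, htT''.le⟩
  have hsm : ∀ s ∈ Icc 0 T'', ContDiff ℝ ∞ (u s) := fun s hs => hS.contDiff_velocity hs
  have hsm3 : ∀ s ∈ Icc 0 T'', ContDiff ℝ 3 (u s) := fun s hs => (hsm s hs).of_le (by norm_cast)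
  have hsm2 : ∀ s ∈ Icc 0 T'', ContDiff ℝ 2 (u s) := fun s hs => (hsm s hs).of_le (by norm_cast)
  have hfin : ∀ n, ∀ s ∈ Icc 0 T'', ∫⁻ x, ‖iteratedFDeriv ℝ n (u s) x‖ₑ ^ 2 < ⊤ := fun n s hs => by
    obtain ⟨Cn, hCn⟩ := hB n
    exact (hCn s hs).trans_lt ENNReal.coe_lt_top
  obtain ⟨B₀, hB₀⟩ := linfty_bound_of_hasBoundedSobolevNormsOn_holds hsm2 hB
  obtain ⟨B₁, hB₁0, hB₁⟩ := exists_forall_norm_fderiv_le_of_hasBoundedSobolevNormsOn hsm3 hB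
  -- Tao's energy class on the slab
  have hfe : ∃ A : ℝ≥0∞, A < ⊤ ∧ ∀ s ∈ Icc 0 T'', ∫⁻ x, ‖u s x‖ₑ ^ 2 ≤ A := by
    obtain ⟨C0, hC0'⟩ := hB 0
    refine ⟨C0, ENNReal.coe_lt_top, fun s hs => ?_⟩
    refine le_trans (le_of_eq (lintegral_congr fun x => ?_)) (hC0' s hs)
    rw [← ofReal_norm, ← ofReal_norm, norm_iteratedFDeriv_zero]
  obtain ⟨hen, -⟩ := hTao ν T'' hν hT''pos u p hS hfe
  have hen' : ∀ s ∈ Icc 0 T'', ∫⁻ x, ‖u s x‖ₑ ^ 2 ≤ ENNReal.ofReal Ē := fun s hs => by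
    rw [hĒ, ENNReal.ofReal_toReal hCE.ne]
    exact hen s hs
  -- the slices on the slab: `L²`, `L^∞` tails
  have hL2 : ∀ s ∈ Icc 0 T'', eLpNorm (u s) 2 volume < ⊤ := fun s hs => by
    refine eLpNorm_two_lt_top_of_lintegral_enorm_sq_lt_top ?_
    exact (hen' s hs).trans_lt ENNReal.ofReal_lt_top
  have hLinf : ∀ s ∈ Icc 0 T'', eLpNorm (u s) ⊤ volume < ⊤ := fun s hs => by
    rw [eLpNorm_exponent_top]
    refine lt_of_le_of_lt (eLpNormEssSup_le_of_ae_enorm_bound (C := ENNReal.ofReal B₀)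
      (Eventually.of_forall fun x => ?_)) ENNReal.ofReal_lt_top
    rw [← ofReal_norm]
    exact ENNReal.ofReal_le_ofReal (hB₀ s hs x)
  -- the stretching estimate at a.e. time of the slab, with the zero weight
  have hω1' : ∀ᵐ s ∂(volume.restrict (Ioo 0 T'')),
      eLpNorm (fun x => curl (u s) x (k + 1)) (3 / 2) volume ≤ ENNReal.ofReal ε :=
    ae_restrict_of_ae_restrict_of_subset (Ioo_subset_Ioo le_rfl hT''T.le) hω1
  have hω2' : ∀ᵐ s ∂(volume.restrict (Ioo 0 T'')),
      eLpNorm (fun x => curl (u s) x (k + 2)) (3 / 2) volume ≤ ENNReal.ofReal ε :=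
    ae_restrict_of_ae_restrict_of_subset (Ioo_subset_Ioo le_rfl hT''T.le) hω2
  have hstrS : ∀ᵐ s ∂(volume.restrict (Ioo 0 T'')),
      2 * ∫ x, ⟪curl (u s) x, fderiv ℝ (u s) x (curl (u s) x)⟫ ≤
        ν * (∫ x, frobeniusNormSq (fderiv ℝ (curl (u s)) x)) +
          (fun _ : ℝ => (0 : ℝ)) s * (∫ x, ‖curl (u s) x‖ ^ 2) := by
    have hmem : ∀ᵐ s ∂(volume.restrict (Ioo 0 T'')), s ∈ Ioo 0 T'' :=
      ae_restrict_mem measurableSet_Ioo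
    filter_upwards [hω1', hω2', hmem] with s h1 h2 hsI
    have hsS : s ∈ Icc 0 T'' := ⟨hsI.1.le, hsI.2.le⟩
    have h := hstrε (u s) (hsm s hsS) (hS.divFree s hsS) (hL2 s hsS) (hLinf s hsS) (hB₁ s hsS)
      (hfin 1 s hsS) (hfin 2 s hsS) h1 h2
    simpa only [zero_mul, add_zero] using h
  -- the enstrophy bound on the slab
  have hAint : ∫⁻ s in Ioo 0 T'', ENNReal.ofReal ((fun _ : ℝ => (0 : ℝ)) s) ≤ ENNReal.ofReal 0 := by
    simp
  have hY := integral_sq_norm_curl_le_mul_exp_of_weight_slab_ae hν hT''pos hS hB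
    (a := fun _ : ℝ => (0 : ℝ)) (fun _ => le_rfl) (A := 0) le_rfl hAint hstrS t htS
  have hYstar_le : ∫ x, ‖curl (u t) x‖ ^ 2 ≤ Y₀ := by
    simpa only [Real.exp_zero, mul_one] using hY
  -- the `H¹` quantity
  have hvt : ContDiff ℝ ∞ (u t) := hS.contDiff_velocity htS
  have hcurl_int : Integrable fun x => ‖curl (u t) x‖ ^ 2 := by
    refine integrable_sq_norm_of_lintegral_lt_top (continuous_curl (hvt.of_le (by norm_cast))) ?_
    exact lt_of_le_of_lt (lintegral_curl_sq_le (u t)) (ENNReal.mul_lt_top ENNReal.ofReal_lt_top (hfin 1 t htS))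
  have hdc : ∫⁻ x, ENNReal.ofReal (frobeniusNormSq (fderiv ℝ (u t) x)) ≤ ENNReal.ofReal Y₀ := by
    refine (lintegral_frobeniusNormSq_fderiv_le_lintegral_sq_norm_curl
      (hvt.of_le (by norm_cast)) (hS.divFree t htS)
      ((hen' t htS).trans_lt ENNReal.ofReal_lt_top)).trans ?_
    rw [show (∫⁻ x, ‖curl (u t) x‖ₑ ^ 2) = ∫⁻ x, ENNReal.ofReal (‖curl (u t) x‖ ^ 2) from
      lintegral_congr fun x => by rw [← ofReal_norm, ENNReal.ofReal_pow (norm_nonneg _)],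
      ← ofReal_integral_eq_lintegral_ofReal hcurl_int (Eventually.of_forall fun x => sq_nonneg _)]
    exact ENNReal.ofReal_le_ofReal hYstar_le
  calc (∫⁻ x, ‖u t x‖ₑ ^ 2) + (∫⁻ x, ENNReal.ofReal (frobeniusNormSq (fderiv ℝ (u t) x)))
      ≤ ENNReal.ofReal Ē + ENNReal.ofReal Y₀ := add_le_add (hen' t htS) hdc
    _ = ENNReal.ofReal (Ē + Y₀) := (ENNReal.ofReal_add hĒ0 hY₀0).symm

/-- **Chae–Choe's criterion, the endpoint alternative: two vorticity components small in
`L^∞(0,T; L^{3/2})`** (Chae–Choe 1999, Thm. 1: "… or if `‖ω̃‖_{L^{∞,3/2}_T}` is sufficiently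
small, then `v` becomes the classical solution on `(0,T]`", in the rendering of the tree's
`constantin_fefferman`, ns.S27). For `ν > 0` there is `ε = ε(ν) > 0` such that: for every
`T > 0`, every classical unforced Navier–Stokes solution `(u, p)` on `ℝ³ × [0, T)` in the
Beale–Kato–Majda class on every `[0, T'']`, `T'' < T`, and every index `k`, if the two OTHER
vorticity components satisfy `‖ω_j(t)‖_{L^{3/2}(ℝ³)} ≤ ε` for a.e. `t ∈ (0, T)`, `j ≠ k`, then
the solution continues in the class past `T` (`HasSobolevExtensionPast ν u T`). The smallness is
component-wise (printed: the two-vector `ω̃`, `|ω_j| ≤ |ω̃| ≤ |ω_{k+1}| + |ω_{k+2}|`), `ε` is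
uniform in `k` (a minimum over the three indices) and is not the printed constant.
[cite: ChaeChoe1999, Thm. 1 (p. 2) and proof, (10)–(11) (p. 5); Chae2007RMI, p. 372 (after (1.8))] -/
theorem chaeChoe_small_two_vorticity_components_criterion {ν : ℝ} (hν : 0 < ν) :
    ∃ ε : ℝ, 0 < ε ∧ ∀ {T : ℝ}, 0 < T →
      ∀ {u : ℝ → (EuclideanSpace ℝ (Fin 3)) → (EuclideanSpace ℝ (Fin 3))}
        {p : ℝ → (EuclideanSpace ℝ (Fin 3)) → ℝ},
      IsClassicalNSSolutionOn (Ico 0 T) ν 0 u p →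
      (∀ T'' < T, HasBoundedSobolevNormsOn (Icc 0 T'') u) →
      ∀ k : Fin 3, (∀ j, j ≠ k → ∀ᵐ t ∂(volume.restrict (Ioo 0 T)),
        eLpNorm (fun x => curl (u t) x j) (3 / 2) volume ≤ ENNReal.ofReal ε) →
      HasSobolevExtensionPast ν u T := by
  choose ε hε0 hε using fun k : Fin 3 => exists_uniform_H1_bound_of_small_two_vorticity_components hν k
  refine ⟨min (ε 0) (min (ε 1) (ε 2)), lt_min (hε0 0) (lt_min (hε0 1) (hε0 2)), ?_⟩
  intro T hT u p hsol hreg k hω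
  have hle : min (ε 0) (min (ε 1) (ε 2)) ≤ ε k := by
    fin_cases k
    · exact min_le_left _ _
    · exact (min_le_right _ _).trans (min_le_left _ _)
    · exact (min_le_right _ _).trans (min_le_right _ _)
  have hω' : ∀ j, j ≠ k → ∀ᵐ t ∂(volume.restrict (Ioo 0 T)),
      eLpNorm (fun x => curl (u t) x j) (3 / 2) volume ≤ ENNReal.ofReal (ε k) := by
    intro j hj
    filter_upwards [hω j hj] with t ht
    exact ht.trans (ENNReal.ofReal_le_ofReal hle)
  obtain ⟨A, hA0, hA⟩ := hε k hT hsol hreg hω'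
  exact hasSobolevExtensionPast_of_uniform_H1_bound hν hT hsol hreg hA0 hA

/-! ### The printed hypothesis `2/α + 3/γ ≤ 2` (Hölder's inequality in time) -/

section Exponent

variable {X : Type*} [MeasureSpace X] {F : Type*} [NormedAddCommGroup F]

/-- **`L^q(S; L^p) ⊂ L^{q'}(S; L^p)` for `q' ≤ q` on a time set of finite measure**, for fields
whose slice norms `t ↦ ‖u(t)‖_{L^p}` are measurable in time (Hölder's inequality in time,
Mathlib's `eLpNorm_le_eLpNorm_mul_rpow_measure_univ`; Serrin 1963, §3: the classes `L^{q}(L^p)`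
decrease in `q` on bounded intervals). The tree's `MemLqLp` does not record time
measurability, whence the explicit hypothesis. [cite: Serrin1963, §3] -/
theorem MemLqLp.of_exponent_le {q q' p : ℝ≥0∞} {u : ℝ → X → F} {S : Set ℝ}
    (h : MemLqLp q p u S) (hq : q' ≤ q) (hS : volume S ≠ ⊤)
    (hm : AEStronglyMeasurable (fun t => (eLpNorm (u t) p volume).toReal) (volume.restrict S)) :
    MemLqLp q' p u S := by
  refine ⟨h.1, ?_⟩
  have h2 : eLpNorm (fun t => (eLpNorm (u t) p volume).toReal) q (volume.restrict S) < ⊤ := h.2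
  rw [eLqLpNorm_def]
  by_cases hq' : q' = 0
  · rw [hq', eLpNorm_exponent_zero]; exact ENNReal.zero_lt_top
  refine (eLpNorm_le_eLpNorm_mul_rpow_measure_univ hq hm).trans_lt ?_
  refine ENNReal.mul_lt_top h2 (ENNReal.rpow_lt_top_of_nonneg ?_ ?_)
  · by_cases hqtop : q = ⊤
    · rw [hqtop, ENNReal.toReal_top, _root_.div_zero, sub_zero]; positivity
    · have hq'top : q' ≠ ⊤ := ne_top_of_le_ne_top hqtop hq
      have hle : q'.toReal ≤ q.toReal := ENNReal.toReal_mono hqtop hq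
      have hpos : 0 < q'.toReal := ENNReal.toReal_pos hq' hq'top
      rw [sub_nonneg]
      exact one_div_le_one_div_of_le hpos hle
  · rw [Measure.restrict_apply_univ]; exact hS

end Exponent

/-- **Time measurability of the `L^γ` norms of the vorticity components of a classical
solution**: for a classical Navier–Stokes solution on `ℝ³ × [0, T)` and `0 < γ < ∞`,
`t ↦ ‖(curl u(t))_j‖_{L^γ}` is a.e.-measurable on `(0, T)` (joint continuity of `∇u` on
`(0,T) × ℝ³`, `IsSmoothSpaceTimeOn.fderiv_slice`, and Tonelli, `AEMeasurable.lintegral_prod_right'`).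
[folklore] -/
private theorem IsClassicalNSSolutionOn.aemeasurable_eLpNorm_curl_apply {ν T : ℝ}
    {u : ℝ → (EuclideanSpace ℝ (Fin 3)) → (EuclideanSpace ℝ (Fin 3))}
    {f : ℝ → (EuclideanSpace ℝ (Fin 3)) → (EuclideanSpace ℝ (Fin 3))}
    {p : ℝ → (EuclideanSpace ℝ (Fin 3)) → ℝ} (hsol : IsClassicalNSSolutionOn (Ico 0 T) ν f u p)
    {γ : ℝ≥0∞} (hγ0 : γ ≠ 0) (hγtop : γ ≠ ⊤) (j : Fin 3) :
    AEMeasurable (fun t => eLpNorm (fun x => curl (u t) x j) γ volume)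
      (volume.restrict (Ioo 0 T)) := by
  have hD : IsSmoothSpaceTimeOn (Ico 0 T) (fun t x => fderiv ℝ (u t) x) :=
    hsol.smooth_velocity.fderiv_slice (uniqueDiffOn_Ico 0 T)
  have hcD : ContinuousOn (fun z : ℝ × EuclideanSpace ℝ (Fin 3) => fderiv ℝ (u z.1) z.2)
      (Ioo 0 T ×ˢ univ) :=
    hD.continuousOn.mono (prod_mono Ioo_subset_Ico_self Subset.rfl)
  have hmeasD : AEStronglyMeasurable (fun z : ℝ × EuclideanSpace ℝ (Fin 3) => fderiv ℝ (u z.1) z.2)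
      ((volume.restrict (Ioo 0 T)).prod volume) := by
    rw [Measure.restrict_prod_eq_prod_univ]
    exact hcD.aestronglyMeasurable (measurableSet_Ioo.prod MeasurableSet.univ)
  have hmj : AEStronglyMeasurable (fun z : ℝ × EuclideanSpace ℝ (Fin 3) => curl (u z.1) z.2 j)
      ((volume.restrict (Ioo 0 T)).prod volume) :=
    ((EuclideanSpace.proj j).continuous.comp curlCLM.continuous).comp_aestronglyMeasurable hmeasD
  have hG : AEMeasurable (fun t => ∫⁻ x, ‖curl (u t) x j‖ₑ ^ γ.toReal) (volume.restrict (Ioo 0 T)) :=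
    (hmj.enorm.pow_const _).lintegral_prod_right'
  have heq : (fun t => eLpNorm (fun x => curl (u t) x j) γ volume) =
      fun t => (∫⁻ x, ‖curl (u t) x j‖ₑ ^ γ.toReal) ^ (1 / γ.toReal) :=
    funext fun t => eLpNorm_eq_lintegral_rpow_enorm_toReal hγ0 hγtop
  rw [heq]
  exact hG.pow_const _

/-- **Chae–Choe's criterion with the printed hypothesis `2/α + 3/γ ≤ 2`** (Chae–Choe 1999,
Thm. 1: "`ω̃ ∈ L^{α,γ}_T` with `2/α + 3/γ ≤ 2`, `1 < α < ∞` and `3/2 < γ < ∞`"). On the bounded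
time interval `(0, T)` the hypothesis with `≤` reduces to the critical one `2/α' + 3/γ = 2`,
`α' = 2γ/(2γ − 3) ≤ α`, by Hölder's inequality in time (`MemLqLp.of_exponent_le`, with the time
measurability of the slice norms of a classical solution,
`IsClassicalNSSolutionOn.aemeasurable_eLpNorm_curl_apply`), and
`chaeChoe_two_vorticity_components_criterion` applies; `α = ∞` is allowed.
[cite: ChaeChoe1999, Thm. 1 and Remark 1 (p. 2); Chae2007RMI, p. 372 (after (1.8))] -/
theorem chaeChoe_two_vorticity_components_criterion_of_le {ν : ℝ} (hν : 0 < ν) {T : ℝ}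
    (hT : 0 < T)
    {u : ℝ → (EuclideanSpace ℝ (Fin 3)) → (EuclideanSpace ℝ (Fin 3))}
    {p : ℝ → (EuclideanSpace ℝ (Fin 3)) → ℝ}
    (hsol : IsClassicalNSSolutionOn (Ico 0 T) ν 0 u p)
    (hreg : ∀ T'' < T, HasBoundedSobolevNormsOn (Icc 0 T'') u)
    {α γ : ℝ≥0∞} (h1α : 1 < α) (hγ : 3 / 2 < γ) (hγtop : γ < ⊤) (hαγ : 2 / α + 3 / γ ≤ 2)
    (k : Fin 3) (hω : ∀ j, j ≠ k → MemLqLp α γ (fun t x => curl (u t) x j) (Ioo 0 T)) :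
    HasSobolevExtensionPast ν u T := by
  -- the real exponent data
  have hγ0 : γ ≠ 0 := (lt_trans (by norm_num) hγ).ne'
  have hγtop' : γ ≠ ⊤ := hγtop.ne
  set ρ : ℝ := γ.toReal with hρ
  have hρ32 : 3 / 2 < ρ := by
    have h := ENNReal.toReal_strict_mono hγtop' hγ
    rwa [ENNReal.toReal_div, ENNReal.toReal_ofNat, ENNReal.toReal_ofNat] at h
  have hρ0 : 0 < ρ := by linarith
  have hγρ : γ = ENNReal.ofReal ρ := (ENNReal.ofReal_toReal hγtop').symm
  set s : ℝ := 1 - 3 / (2 * ρ) with hs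
  have h32 : 3 / (2 * ρ) = 3 / ρ / 2 := by
    rw [mul_comm, ← div_div]
  have hs0 : 0 < s := by
    rw [hs, sub_pos, div_lt_one (by positivity)]; linarith
  have hs1 : s < 1 := by
    rw [hs]; linarith [div_pos (zero_lt_three' ℝ) (by positivity : (0 : ℝ) < 2 * ρ)]
  -- the critical time exponent `α'`, `2/α' + 3/γ = 2`
  set α' : ℝ≥0∞ := ENNReal.ofReal (1 / s) with hα'
  have h1s : 1 < 1 / s := by rw [lt_div_iff₀ hs0]; linarith
  have h1α' : 1 < α' := by
    rw [hα', ← ENNReal.ofReal_one]; exact (ENNReal.ofReal_lt_ofReal_iff (by positivity)).2 h1s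
  have hα'top : α' < ⊤ := ENNReal.ofReal_lt_top
  have hα'γ : 2 / α' + 3 / γ = 2 := by
    rw [hα', hγρ, show (2 : ℝ≥0∞) = ENNReal.ofReal 2 by norm_num,
      show (3 : ℝ≥0∞) = ENNReal.ofReal 3 by norm_num,
      ← ENNReal.ofReal_div_of_pos (by positivity : (0 : ℝ) < 1 / s),
      ← ENNReal.ofReal_div_of_pos hρ0, ← ENNReal.ofReal_add (by positivity) (by positivity)]
    congr 1
    rw [hs]; field_simp; ring
  -- `α' ≤ α`
  have hα'α : α' ≤ α := by
    by_cases hαtop : α = ⊤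
    · rw [hαtop]; exact le_top
    · have hα0 : α ≠ 0 := (lt_trans zero_lt_one h1α).ne'
      have ha0 : 0 < α.toReal := ENNReal.toReal_pos hα0 hαtop
      have h2 : 2 / α.toReal + 3 / ρ ≤ 2 := by
        have hfin1 : 2 / α ≠ ⊤ := ENNReal.div_ne_top (by norm_num) hα0
        have hfin2 : 3 / γ ≠ ⊤ := ENNReal.div_ne_top (by norm_num) hγ0
        have h := (ENNReal.toReal_le_toReal (ENNReal.add_ne_top.2 ⟨hfin1, hfin2⟩) (by norm_num)).2 hαγ
        rw [ENNReal.toReal_add hfin1 hfin2, ENNReal.toReal_div, ENNReal.toReal_div,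
          ENNReal.toReal_ofNat, ENNReal.toReal_ofNat] at h
        exact h
      have h2' : 2 / α.toReal ≤ 2 - 3 / ρ := by linarith
      have h2'' : 2 ≤ (2 - 3 / ρ) * α.toReal := (div_le_iff₀ ha0).1 h2'
      have h3 : 1 / s ≤ α.toReal := by
        rw [div_le_iff₀ hs0, hs, h32]
        linarith
      calc α' = ENNReal.ofReal (1 / s) := rfl
        _ ≤ ENNReal.ofReal α.toReal := ENNReal.ofReal_le_ofReal h3
        _ = α := ENNReal.ofReal_toReal hαtop
  -- Hölder in time
  have hω' : ∀ j, j ≠ k → MemLqLp α' γ (fun t x => curl (u t) x j) (Ioo 0 T) := by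
    intro j hj
    refine (hω j hj).of_exponent_le hα'α measure_Ioo_lt_top.ne ?_
    exact (ENNReal.measurable_toReal.comp_aemeasurable
      (hsol.aemeasurable_eLpNorm_curl_apply hγ0 hγtop' j)).aestronglyMeasurable
  exact chaeChoe_two_vorticity_components_criterion hν hT hsol hreg h1α' hα'top hα'γ k hω'

/-- **Unidirectional vorticity: continuation** (Chae–Choe 1999, Remark 2: "as another immediate
corollary we obtain the global regularity for the 2-D Navier–Stokes equations, since in this case
`ω̃(x,t) = 0`"). If two of the vorticity components of a classical unforced solution on
`ℝ³ × [0, T)` in the Beale–Kato–Majda class vanish identically on `(0, T)`, the solution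
continues in the class past `T` (the hypothesis of `chaeChoe_two_vorticity_components_criterion`
holds trivially, e.g. with `α = 2`, `γ = 3`). [cite: ChaeChoe1999, Remark 2 (p. 2)] -/
theorem hasSobolevExtensionPast_of_two_vorticity_components_eq_zero {ν : ℝ} (hν : 0 < ν)
    {T : ℝ} (hT : 0 < T)
    {u : ℝ → (EuclideanSpace ℝ (Fin 3)) → (EuclideanSpace ℝ (Fin 3))}
    {p : ℝ → (EuclideanSpace ℝ (Fin 3)) → ℝ}
    (hsol : IsClassicalNSSolutionOn (Ico 0 T) ν 0 u p)
    (hreg : ∀ T'' < T, HasBoundedSobolevNormsOn (Icc 0 T'') u) (k : Fin 3)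
    (hzero : ∀ j, j ≠ k → ∀ t ∈ Ioo 0 T, ∀ x, curl (u t) x j = 0) :
    HasSobolevExtensionPast ν u T := by
  have h22 : (2 : ℝ≥0∞) / 2 + 3 / 3 = 2 := by
    rw [ENNReal.div_self two_ne_zero ENNReal.ofNat_ne_top,
      ENNReal.div_self three_ne_zero ENNReal.ofNat_ne_top, one_add_one_eq_two]
  refine chaeChoe_two_vorticity_components_criterion hν hT hsol hreg (α := 2) (γ := 3)
    (by norm_num) ENNReal.ofNat_lt_top h22 k ?_
  intro j hj
  have hae : ∀ᵐ t ∂(volume.restrict (Ioo 0 T)),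
      (fun x => curl (u t) x j) = fun _ => (0 : ℝ) :=
    (ae_restrict_mem measurableSet_Ioo).mono fun t ht => funext fun x => hzero j hj t ht x
  refine ⟨hae.mono fun t ht => by beta_reduce; rw [ht]; exact MemLp.zero', ?_⟩
  rw [eLqLpNorm_def]
  have hae' : (fun t => (eLpNorm (fun x => curl (u t) x j) 3 volume).toReal) =ᵐ[volume.restrict (Ioo 0 T)]
      fun _ => (0 : ℝ) :=
    hae.mono fun t ht => by simp only [ht, eLpNorm_zero', ENNReal.toReal_zero]
  rw [eLpNorm_congr_ae hae', eLpNorm_zero']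
  exact ENNReal.zero_lt_top

end Literature.Analysis.FluidPDE
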